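import Literature.Geometry.Manifold.CylinderSlice
import Literature.MeasureTheory.Hausdorff.SphereAreaGeneral
import Mathlib.Analysis.SpecialFunctions.Exponential
import Mathlib.Analysis.Complex.ExponentialBounds
import Mathlib.Analysis.SpecificLimits.Basic
import Mathlib.Analysis.Convex.PathConnected
import HarnessLib

/-!
# The slice-normalised heat-kernel ("cylinder") entropy of subsets of `S⁴ × ℝ ⊂ ℝ⁶`: definition and
# large-scale behaviour

Topic `Literature/Geometry/Riemannian` (NOT the Euclidean round-cylinder entropy of `CylinderEntropy.lean`;
this is the functional of route `SmoothPoincare4/CylinderEntropy`, definition request D1 of its planner,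
written by the standing disprover of its crux `SliceIsolation`, refuter-cdisprove-stmt-SmoothPoincare4-7632-0,
from the exact typed expressions of the route items).

For a subset `A` of the round cylinder `N = {z ∈ ℝ⁶ | ∑_{i<5} zᵢ² = 1} = S⁴ × ℝ`, a centre `p ∈ N` and a
scale `τ > 0`, the items integrate against `μH[4]` on `ℝ⁶` the kernel
`𝔥(τ, ⟨z', p'⟩) · e^{-(z₅ - p₅)²/4τ}`, where `𝔥(τ, s) = ∑_k e^{-k(k+3)τ} (2k+3)/3 · C_k^{(3/2)}(s)` is
`vol(S⁴)` times the zonal heat kernel of `S⁴` (eigenvalues `k(k+3)`, zonal harmonics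
`(dim H_k / C_k(1)) C_k^{(3/2)} = (2k+3)/3 · C_k^{(3/2)}`, `C_k^{(3/2)}` as the finite sum DLMF 18.5.10),
normalise by `μH[4](S⁴ ⊂ ℝ⁵)` (`cylDensity`), and take the supremum over `p ∈ N`, `τ > 0`
(`cylEntropy`, "`λ_cyl`"); this is Hamilton's Gaussian density for the product backward heat kernel of the
5-manifold `N` (Hamilton, Comm. Anal. Geom. 1 (1993) 127–137), normalised so that slices are calibrated.

Proved here (everything; no facts, no `Prop`-valued definitions):
* `hausdorffMeasure_sphere_four_pos`, `hausdorffMeasure_sphere_four_lt_top` — the normalising constant is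
  non-degenerate for Mathlib's un-normalised `μH` (via the tree's `μHE` results);
* `abs_gegen_le`, `key_ineq`, `abs_term_le`, `summable_term`, `one_sub_tail_le_zonal` — the typed series is
  summable for `τ ≥ 1`, `|s| ≤ 1`, with `𝔥(τ, s) ≥ 1 - e^{-τ}/(1 - e^{-τ})` (the `k = 0` mode is `1`, the rest
  is dominated by a geometric series through the crude bounds `|C_k^{(3/2)}| ≤ (k+1)(k+1)! 2^k` and
  `(2k+3)(k+1)(k+1)! 2^k ≤ 3 e^{k(k+2)}`);
* `measure_ratio_le_cylEntropy` — **`μH[4](A)/μH[4](S⁴) ≤ λ_cyl(A)`** for measurable `A ⊆ N` of bounded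
  height (the `τ → ∞` end of the supremum, centred on the slice through `e₀`);
* `one_le_cylEntropy_slice` — **`1 ≤ λ_cyl(S⁴ × {c})`** (isometry invariance of `μH`; the "≥" half of the
  route's calibration item `SliceCalibration`; the "≤" half is a Funk–Hecke computation not done here);
* `hausdorffMeasure_sphere_le_of_separatesEnds` — **area floor**: a set separating the ends of `N` (typed
  `JoinedIn` predicate) has `μH[4] ≥ μH[4](S⁴)` (1-Lipschitz shadow ⊇ `S⁴`; the route's item `AreaFloor`);
* `one_le_cylEntropy_of_separatesEnds` — hence bounded measurable separating sets have `λ_cyl ≥ 1`.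

## References
* R. S. Hamilton, *Monotonicity formulas for parabolic flows on manifolds*, Comm. Anal. Geom. 1 (1993),
  127–137 (the density); *A matrix Harnack estimate for the heat equation*, ibid. 113–126.
* NIST DLMF §18.5.10 (explicit sum for `C_n^{(λ)}`); H. Federer, *Geometric Measure Theory* (1969), 2.10.11.
-/

noncomputable section

open scoped BigOperators Topology ENNReal
open Filter Set Function MeasureTheory Finset Literature.Geometry.Manifold.CylinderSlice

namespace Literature.Geometry.Riemannian.SphericalCylinderEntropy

/-! ### The typed functional -/

/-- The typed slice-normalised backward heat kernel of `N` centred at `p` at scale `τ`: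
`𝔥(τ, ⟨z', p'⟩) · e^{-(z₅-p₅)²/4τ}` with `𝔥 = vol(S⁴)·H_{S⁴}` written as its Gegenbauer series. [folklore] -/
def cylKernel (p : EuclideanSpace ℝ (Fin 6)) (τ : ℝ) (z : EuclideanSpace ℝ (Fin 6)) : ℝ :=
  (∑' k : ℕ, Real.exp (-((k : ℝ) * ((k : ℝ) + 3)) * τ) * ((2 * (k : ℝ) + 3) / 3) *
    ∑ l ∈ Finset.range (k / 2 + 1), (-1 : ℝ) ^ l *
      (∏ j ∈ Finset.range (k - l), ((3 : ℝ) / 2 + (j : ℝ))) /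
        (((l.factorial : ℕ) : ℝ) * (((k - 2 * l).factorial : ℕ) : ℝ)) *
      (2 * ∑ i : Fin 5, z (Fin.castSucc i) * p (Fin.castSucc i)) ^ (k - 2 * l)) *
    Real.exp (-((z 5 - p 5) ^ 2) / (4 * τ))

/-- The typed slice-normalised Gaussian density `F̂_{p,τ}(A)` of a subset `A ⊆ ℝ⁶`. [folklore] -/
def cylDensity (A : Set (EuclideanSpace ℝ (Fin 6))) (p : EuclideanSpace ℝ (Fin 6)) (τ : ℝ) : ℝ≥0∞ :=
  (μH[4] (Metric.sphere (0 : EuclideanSpace ℝ (Fin 5)) 1))⁻¹ *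
    ∫⁻ z in A, ENNReal.ofReal (cylKernel p τ z) ∂μH[4]

/-- The typed cylinder entropy `λ_cyl(A) = sup_{p ∈ N, τ > 0} F̂_{p,τ}(A)`. [folklore] -/
def cylEntropy (A : Set (EuclideanSpace ℝ (Fin 6))) : ℝ≥0∞ :=
  ⨆ (p : EuclideanSpace ℝ (Fin 6)) (_ : ∑ i : Fin 5, p (Fin.castSucc i) ^ 2 = 1) (τ : ℝ) (_ : 0 < τ),
    cylDensity A p τ


/-! ### The normalising constant `μH[4](S⁴ ⊂ ℝ⁵)` is non-degenerate -/

/-- **`0 < μH[4](S⁴ ⊂ ℝ⁵)`** for Mathlib's (un-normalised) Hausdorff measure: Mathlib's normalised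
`μHE[4] = c • μH[4]` (`c = addHaarScalarFactor …`) is positive on the unit sphere by the tree's
`euclideanHausdorffMeasure_unitSphere_pos` (which identifies it with the polar surface measure).  Guards
against the collapse "`(μH[4] S⁴)⁻¹ = ⊤` ⇒ every non-null cross-section has `λ_cyl = ⊤` ⇒ crux vacuously
true". [folklore] -/
theorem hausdorffMeasure_sphere_four_pos :
    0 < μH[4] (Metric.sphere (0 : EuclideanSpace ℝ (Fin 5)) 1) := by
  have h := Literature.MeasureTheory.Hausdorff.euclideanHausdorffMeasure_unitSphere_pos
    (E := EuclideanSpace ℝ (Fin 5)) (d := 4) finrank_euclideanSpace_fin (by norm_num)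
  rw [Measure.euclideanHausdorffMeasure_def, Measure.smul_apply, ENNReal.smul_def] at h
  exact (ENNReal.mul_pos_iff.1 h).2

/-- **`μH[4](S⁴ ⊂ ℝ⁵) < ⊤`** (tree: `hausdorffMeasure_sphere_lt_top`).  Guards against the collapse
"`(μH[4] S⁴)⁻¹ = 0` ⇒ every cross-section has `λ_cyl = 0 < 1 + ε` ⇒ crux ⇔ (SPC4 for cross-sections)". [folklore] -/
theorem hausdorffMeasure_sphere_four_lt_top :
    μH[4] (Metric.sphere (0 : EuclideanSpace ℝ (Fin 5)) 1) < ⊤ :=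
  Literature.MeasureTheory.Hausdorff.hausdorffMeasure_sphere_lt_top (E := EuclideanSpace ℝ (Fin 5))
    (d := 4) finrank_euclideanSpace_fin 1

/-- Hence the normalising factor of the typed density is neither `0` nor `⊤`, and `F̂_{p,τ}(A)` vanishes /
blows up exactly when the kernel integral does. [folklore] -/
theorem inv_hausdorffMeasure_sphere_four_ne_zero_ne_top :
    (μH[4] (Metric.sphere (0 : EuclideanSpace ℝ (Fin 5)) 1))⁻¹ ≠ 0 ∧
      (μH[4] (Metric.sphere (0 : EuclideanSpace ℝ (Fin 5)) 1))⁻¹ ≠ ⊤ :=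
  ⟨ENNReal.inv_ne_zero.2 hausdorffMeasure_sphere_four_lt_top.ne,
    ENNReal.inv_ne_top.2 hausdorffMeasure_sphere_four_pos.ne'⟩

/-- The typed density is `⊤` iff the kernel integral is (the constant being non-degenerate). [folklore] -/
theorem cylDensity_eq_top_iff (A : Set (EuclideanSpace ℝ (Fin 6))) (p : EuclideanSpace ℝ (Fin 6)) (τ : ℝ) :
    cylDensity A p τ = ⊤ ↔ ∫⁻ z in A, ENNReal.ofReal (cylKernel p τ z) ∂μH[4] = ⊤ := by
  rw [cylDensity, ENNReal.mul_eq_top]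
  have h := inv_hausdorffMeasure_sphere_four_ne_zero_ne_top
  constructor
  · rintro (⟨-, h2⟩ | ⟨h1, -⟩)
    · exact h2
    · exact absurd h1 h.2
  · intro ht
    exact Or.inl ⟨h.1, ht⟩

/-- The typed density is `0` iff the kernel integral is. [folklore] -/
theorem cylDensity_eq_zero_iff (A : Set (EuclideanSpace ℝ (Fin 6))) (p : EuclideanSpace ℝ (Fin 6)) (τ : ℝ) :
    cylDensity A p τ = 0 ↔ ∫⁻ z in A, ENNReal.ofReal (cylKernel p τ z) ∂μH[4] = 0 := by
  rw [cylDensity, mul_eq_zero]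
  have h := inv_hausdorffMeasure_sphere_four_ne_zero_ne_top
  constructor
  · rintro (h1 | h2)
    · exact absurd h1 h.1
    · exact h2
  · intro h0
    exact Or.inr h0


/-! ### Large scales: summability and the `k = 0` mode -/


/-- The typed Gegenbauer polynomial `C_k^{(3/2)}(s)` as its finite sum (DLMF 18.5.10). [folklore] -/
def gegen (k : ℕ) (s : ℝ) : ℝ :=
  ∑ l ∈ Finset.range (k / 2 + 1), (-1 : ℝ) ^ l *
    (∏ j ∈ Finset.range (k - l), ((3 : ℝ) / 2 + (j : ℝ))) /
      (((l.factorial : ℕ) : ℝ) * (((k - 2 * l).factorial : ℕ) : ℝ)) * (2 * s) ^ (k - 2 * l)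

/-- The typed heat weights `e^{-k(k+3)τ} (2k+3)/3`. [folklore] -/
def wt (k : ℕ) (τ : ℝ) : ℝ := Real.exp (-((k : ℝ) * ((k : ℝ) + 3)) * τ) * ((2 * (k : ℝ) + 3) / 3)

/-- The typed zonal kernel `𝔥(τ, s) = vol(S⁴) H_{S⁴}` as the `tsum`. [folklore] -/
def zonal (τ s : ℝ) : ℝ := ∑' k : ℕ, wt k τ * gegen k s

/-- `C_0^{(3/2)} = 1`. [folklore] -/
@[simp] theorem gegen_zero (s : ℝ) : gegen 0 s = 1 := by
  simp [gegen]

/-- The `k = 0` weight is `1`. [folklore] -/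
@[simp] theorem wt_zero (τ : ℝ) : wt 0 τ = 1 := by
  simp [wt]

/-- `∏_{j<n} (3/2 + j) ≤ (n+1)!`. [folklore] -/
theorem prod_threeHalves_le (n : ℕ) :
    ∏ j ∈ Finset.range n, ((3 : ℝ) / 2 + (j : ℝ)) ≤ ((n + 1).factorial : ℝ) := by
  induction n with
  | zero => simp
  | succ n ih =>
    rw [Finset.prod_range_succ, Nat.factorial_succ (n + 1), Nat.cast_mul]
    have h0 : 0 ≤ ∏ j ∈ Finset.range n, ((3 : ℝ) / 2 + (j : ℝ)) :=
      Finset.prod_nonneg fun j _ => by positivity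
    have h1 : (3 : ℝ) / 2 + (n : ℝ) ≤ ((n + 1 + 1 : ℕ) : ℝ) := by push_cast; linarith
    calc (∏ j ∈ Finset.range n, ((3 : ℝ) / 2 + (j : ℝ))) * ((3 : ℝ) / 2 + (n : ℝ))
        ≤ ((n + 1).factorial : ℝ) * ((n + 1 + 1 : ℕ) : ℝ) :=
          mul_le_mul ih h1 (by positivity) (by positivity)
      _ = ((n + 1 + 1 : ℕ) : ℝ) * ((n + 1).factorial : ℝ) := by ring

/-- The Pochhammer product `(3/2)_n` is non-negative. [folklore] -/
theorem prod_threeHalves_nonneg (n : ℕ) : 0 ≤ ∏ j ∈ Finset.range n, ((3 : ℝ) / 2 + (j : ℝ)) :=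
  Finset.prod_nonneg fun j _ => by positivity

/-- Crude bound `|C_k^{(3/2)}(s)| ≤ (k+1) (k+1)! 2^k` for `|s| ≤ 1`. [folklore] -/
theorem abs_gegen_le (k : ℕ) {s : ℝ} (hs : |s| ≤ 1) :
    |gegen k s| ≤ ((k : ℝ) + 1) * ((k + 1).factorial : ℝ) * 2 ^ k := by
  unfold gegen
  refine (Finset.abs_sum_le_sum_abs _ _).trans ?_
  have hterm : ∀ l ∈ Finset.range (k / 2 + 1),
      |(-1 : ℝ) ^ l * (∏ j ∈ Finset.range (k - l), ((3 : ℝ) / 2 + (j : ℝ))) /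
        (((l.factorial : ℕ) : ℝ) * (((k - 2 * l).factorial : ℕ) : ℝ)) * (2 * s) ^ (k - 2 * l)|
        ≤ ((k + 1).factorial : ℝ) * 2 ^ k := by
    intro l _
    rw [abs_mul, abs_div, abs_mul, abs_pow, abs_neg, abs_one, one_pow, one_mul,
      abs_of_nonneg (prod_threeHalves_nonneg _), abs_pow,
      abs_of_pos (show (0 : ℝ) < ((l.factorial : ℕ) : ℝ) * (((k - 2 * l).factorial : ℕ) : ℝ) by
        positivity)]
    have hP : (∏ j ∈ Finset.range (k - l), ((3 : ℝ) / 2 + (j : ℝ))) ≤ ((k + 1).factorial : ℝ) :=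
      (prod_threeHalves_le _).trans (by exact_mod_cast Nat.factorial_le (by omega))
    have hden : (1 : ℝ) ≤ ((l.factorial : ℕ) : ℝ) * (((k - 2 * l).factorial : ℕ) : ℝ) := by
      have h1 : (1 : ℝ) ≤ ((l.factorial : ℕ) : ℝ) := by exact_mod_cast Nat.factorial_pos l
      have h2 : (1 : ℝ) ≤ (((k - 2 * l).factorial : ℕ) : ℝ) := by exact_mod_cast Nat.factorial_pos _
      nlinarith
    have hpow : |2 * s| ^ (k - 2 * l) ≤ (2 : ℝ) ^ k := by
      have h2s : |2 * s| ≤ 2 := by rw [abs_mul, abs_two]; linarith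
      calc |2 * s| ^ (k - 2 * l) ≤ (2 : ℝ) ^ (k - 2 * l) :=
            pow_le_pow_left₀ (abs_nonneg _) h2s _
        _ ≤ 2 ^ k := pow_le_pow_right₀ (by norm_num) (by omega)
    calc (∏ j ∈ Finset.range (k - l), ((3 : ℝ) / 2 + (j : ℝ))) /
          (((l.factorial : ℕ) : ℝ) * (((k - 2 * l).factorial : ℕ) : ℝ)) * |2 * s| ^ (k - 2 * l)
        ≤ ((k + 1).factorial : ℝ) / 1 * 2 ^ k := by
          refine mul_le_mul (div_le_div₀ (by positivity) hP one_pos hden) hpow (by positivity)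
            (by positivity)
      _ = ((k + 1).factorial : ℝ) * 2 ^ k := by rw [div_one]
  refine (Finset.sum_le_sum hterm).trans ?_
  rw [Finset.sum_const, Finset.card_range, nsmul_eq_mul]
  have hk : ((k / 2 + 1 : ℕ) : ℝ) ≤ (k : ℝ) + 1 := by
    have : k / 2 + 1 ≤ k + 1 := by omega
    exact_mod_cast this
  have h0 : 0 ≤ ((k + 1).factorial : ℝ) * 2 ^ k := by positivity
  nlinarith

/-- `8 (k+2) ≤ e^{2k+3}` for `k ≥ 1` (via `x⁴/4! ≤ eˣ`). [folklore] -/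
theorem eight_mul_le_exp (k : ℕ) (hk : 1 ≤ k) :
    8 * ((k : ℝ) + 2) ≤ Real.exp (2 * (k : ℝ) + 3) := by
  have hx : (1 : ℝ) ≤ k := by exact_mod_cast hk
  have h1 : (2 * (k : ℝ) + 3) ^ 4 / (Nat.factorial 4 : ℕ) ≤ Real.exp (2 * (k : ℝ) + 3) :=
    Real.pow_div_factorial_le_exp _ (by positivity) 4
  have h4 : ((Nat.factorial 4 : ℕ) : ℝ) = 24 := by norm_num [Nat.factorial]
  rw [h4] at h1
  have h2 : 8 * ((k : ℝ) + 2) ≤ (2 * (k : ℝ) + 3) ^ 4 / 24 := by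
    rw [le_div_iff₀ (by norm_num : (0 : ℝ) < 24)]
    nlinarith [sq_nonneg ((k : ℝ) - 1), sq_nonneg (k : ℝ), mul_nonneg (sub_nonneg.2 hx) (sq_nonneg (k : ℝ))]
  exact h2.trans h1

/-- The key growth inequality `(2k+3)(k+1)(k+1)! 2^k ≤ 3 e^{k(k+2)}` for `k ≥ 1`. [folklore] -/
theorem key_ineq (k : ℕ) (hk : 1 ≤ k) :
    (2 * (k : ℝ) + 3) * ((k : ℝ) + 1) * ((k + 1).factorial : ℝ) * 2 ^ k ≤
      3 * Real.exp ((k : ℝ) * ((k : ℝ) + 2)) := by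
  induction k, hk using Nat.le_induction with
  | base =>
    have he : (2.7182818283 : ℝ) < Real.exp 1 := Real.exp_one_gt_d9
    have h3 : (20 : ℝ) < Real.exp 3 := by
      have h13 : Real.exp 3 = Real.exp 1 ^ 3 := by rw [Real.exp_one_pow]; norm_num
      rw [h13]
      nlinarith [he, Real.exp_pos 1, mul_pos (Real.exp_pos 1) (Real.exp_pos 1)]
    norm_num [Nat.factorial]
    linarith
  | succ k hk ih =>
    have hx : (1 : ℝ) ≤ k := by exact_mod_cast hk
    have hfac : ((k + 1 + 1).factorial : ℝ) = ((k : ℝ) + 2) * ((k + 1).factorial : ℝ) := by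
      rw [Nat.factorial_succ (k + 1)]; push_cast; ring
    -- LHS(k+1) ≤ 8 (k+2) LHS(k)
    have hL0 : 0 ≤ (2 * (k : ℝ) + 3) * ((k : ℝ) + 1) * ((k + 1).factorial : ℝ) * 2 ^ k := by positivity
    have hstep : (2 * ((k + 1 : ℕ) : ℝ) + 3) * (((k + 1 : ℕ) : ℝ) + 1) * ((k + 1 + 1).factorial : ℝ) *
        2 ^ (k + 1) ≤ 8 * ((k : ℝ) + 2) *
        ((2 * (k : ℝ) + 3) * ((k : ℝ) + 1) * ((k + 1).factorial : ℝ) * 2 ^ k) := by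
      rw [hfac, pow_succ]
      push_cast
      have hf0 : (0 : ℝ) < ((k + 1).factorial : ℝ) := by positivity
      have hp0 : (0 : ℝ) < 2 ^ k := by positivity
      nlinarith [mul_pos hf0 hp0, mul_pos (mul_pos hf0 hp0) (show (0:ℝ) < k by linarith)]
    have hexp : 8 * ((k : ℝ) + 2) * (3 * Real.exp ((k : ℝ) * ((k : ℝ) + 2))) ≤
        3 * Real.exp (((k + 1 : ℕ) : ℝ) * (((k + 1 : ℕ) : ℝ) + 2)) := by
      have h8 := eight_mul_le_exp k hk
      have hsplit : Real.exp (((k + 1 : ℕ) : ℝ) * (((k + 1 : ℕ) : ℝ) + 2)) =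
          Real.exp ((k : ℝ) * ((k : ℝ) + 2)) * Real.exp (2 * (k : ℝ) + 3) := by
        rw [← Real.exp_add]; push_cast; ring_nf
      rw [hsplit]
      nlinarith [Real.exp_pos ((k : ℝ) * ((k : ℝ) + 2)), Real.exp_pos (2 * (k : ℝ) + 3)]
    calc _ ≤ 8 * ((k : ℝ) + 2) * ((2 * (k : ℝ) + 3) * ((k : ℝ) + 1) * ((k + 1).factorial : ℝ) * 2 ^ k) :=
          hstep
      _ ≤ 8 * ((k : ℝ) + 2) * (3 * Real.exp ((k : ℝ) * ((k : ℝ) + 2))) :=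
          mul_le_mul_of_nonneg_left ih (by positivity)
      _ ≤ _ := hexp

/-- The heat weights are positive. [folklore] -/
theorem wt_pos (k : ℕ) (τ : ℝ) : 0 < wt k τ := by unfold wt; positivity

/-- **Term bound**: for `τ ≥ 1` and `|s| ≤ 1`, `|wt k τ · C_k(s)| ≤ (e^{-τ})^k`. [folklore] -/
theorem abs_term_le (k : ℕ) {τ s : ℝ} (hτ : 1 ≤ τ) (hs : |s| ≤ 1) :
    |wt k τ * gegen k s| ≤ Real.exp (-τ) ^ k := by
  rcases Nat.eq_zero_or_pos k with rfl | hk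
  · simp
  · have hg := abs_gegen_le k hs
    have hkey := key_ineq k hk
    have hk1 : (1 : ℝ) ≤ k := by exact_mod_cast hk
    rw [abs_mul, abs_of_pos (wt_pos k τ), ← Real.exp_nat_mul, wt]
    have hM0 : 0 ≤ ((k : ℝ) + 1) * ((k + 1).factorial : ℝ) * 2 ^ k := by positivity
    calc Real.exp (-((k : ℝ) * ((k : ℝ) + 3)) * τ) * ((2 * (k : ℝ) + 3) / 3) * |gegen k s|
        ≤ Real.exp (-((k : ℝ) * ((k : ℝ) + 3)) * τ) * ((2 * (k : ℝ) + 3) / 3) *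
            (((k : ℝ) + 1) * ((k + 1).factorial : ℝ) * 2 ^ k) :=
          mul_le_mul_of_nonneg_left hg (by positivity)
      _ ≤ Real.exp (-((k : ℝ) * ((k : ℝ) + 3)) * τ) * Real.exp ((k : ℝ) * ((k : ℝ) + 2)) := by
          rw [mul_assoc]
          refine mul_le_mul_of_nonneg_left ?_ (Real.exp_pos _).le
          nlinarith
      _ = Real.exp (-((k : ℝ) * ((k : ℝ) + 3)) * τ + (k : ℝ) * ((k : ℝ) + 2)) := by rw [Real.exp_add]
      _ ≤ Real.exp ((k : ℕ) * (-τ)) := by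
          rw [Real.exp_le_exp]
          nlinarith [mul_nonneg (mul_nonneg (by positivity : (0 : ℝ) ≤ k) (by positivity : (0 : ℝ) ≤ (k : ℝ) + 2)) (sub_nonneg.2 hτ)]

/-- Summability of the typed series for `τ ≥ 1`, `|s| ≤ 1`. [folklore] -/
theorem summable_term {τ s : ℝ} (hτ : 1 ≤ τ) (hs : |s| ≤ 1) :
    Summable fun k : ℕ => wt k τ * gegen k s := by
  refine Summable.of_norm_bounded (g := fun k : ℕ => Real.exp (-τ) ^ k) ?_ fun k => ?_
  · exact summable_geometric_of_lt_one (Real.exp_pos _).le (by rw [Real.exp_lt_one_iff]; linarith)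
  · rw [Real.norm_eq_abs]; exact abs_term_le k hτ hs

/-- The tail `t(τ) = e^{-τ}/(1 - e^{-τ})` of the geometric majorant. [folklore] -/
def tail (τ : ℝ) : ℝ := Real.exp (-τ) / (1 - Real.exp (-τ))

/-- **Large-scale lower bound of the typed zonal kernel**: `𝔥(τ, s) ≥ 1 - t(τ)` for `τ ≥ 1`,
`|s| ≤ 1` (the `k = 0` mode is `1`, the rest is dominated by a geometric series). [folklore] -/
theorem one_sub_tail_le_zonal {τ s : ℝ} (hτ : 1 ≤ τ) (hs : |s| ≤ 1) : 1 - tail τ ≤ zonal τ s := by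
  have hsum := summable_term hτ hs
  have hr0 : 0 ≤ Real.exp (-τ) := (Real.exp_pos _).le
  have hr1 : Real.exp (-τ) < 1 := by rw [Real.exp_lt_one_iff]; linarith
  rw [zonal, hsum.tsum_eq_zero_add]
  simp only [wt_zero, gegen_zero, mul_one]
  have hgeom : HasSum (fun k : ℕ => Real.exp (-τ) ^ (k + 1)) (tail τ) := by
    have h := (hasSum_geometric_of_lt_one hr0 hr1).mul_left (Real.exp (-τ))
    simp only [← pow_succ'] at h
    rw [tail, div_eq_mul_inv]
    exact h
  have hbound : |∑' k : ℕ, wt (k + 1) τ * gegen (k + 1) s| ≤ tail τ := by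
    have h := tsum_of_norm_bounded hgeom (fun k => by
      rw [Real.norm_eq_abs]; exact abs_term_le (k + 1) hτ hs)
    simpa [Real.norm_eq_abs] using h
  linarith [neg_abs_le (∑' k : ℕ, wt (k + 1) τ * gegen (k + 1) s)]


/-! #### From the zonal bound to the typed density -/

/-- The typed kernel is `zonal τ ⟨z', p'⟩ · e^{-(z₅-p₅)²/4τ}` (definitional). [folklore] -/
theorem cylKernel_eq (p : EuclideanSpace ℝ (Fin 6)) (τ : ℝ) (z : EuclideanSpace ℝ (Fin 6)) :
    cylKernel p τ z = zonal τ (∑ i : Fin 5, z (Fin.castSucc i) * p (Fin.castSucc i)) *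
      Real.exp (-((z 5 - p 5) ^ 2) / (4 * τ)) := rfl

/-- Cauchy–Schwarz on the base `S⁴`: `|⟨z', p'⟩| ≤ 1` for `z, p ∈ N`. [folklore] -/
theorem abs_sum_mul_le_one {z p : EuclideanSpace ℝ (Fin 6)}
    (hz : ∑ i : Fin 5, z (Fin.castSucc i) ^ 2 = 1) (hp : ∑ i : Fin 5, p (Fin.castSucc i) ^ 2 = 1) :
    |∑ i : Fin 5, z (Fin.castSucc i) * p (Fin.castSucc i)| ≤ 1 := by
  rw [← sq_le_one_iff_abs_le_one]
  have h := Finset.sum_mul_sq_le_sq_mul_sq Finset.univ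
    (fun i : Fin 5 => z (Fin.castSucc i)) (fun i : Fin 5 => p (Fin.castSucc i))
  simp only [hz, hp, mul_one] at h
  exact h

/-- **Pointwise lower bound of the typed kernel at large scales**: for `τ ≥ 1`, a centre `q ∈ N` on
the slice `{z₅ = 0}` and a point `z ∈ N` with `|z₅| ≤ B`,
`(1 - t(τ)) e^{-B²/4τ} ≤ K_{q,τ}(z)` whenever `t(τ) ≤ 1`. [folklore] -/
theorem lowerFactor_le_cylKernel {z q : EuclideanSpace ℝ (Fin 6)} {B τ : ℝ}
    (hz : ∑ i : Fin 5, z (Fin.castSucc i) ^ 2 = 1) (hq : ∑ i : Fin 5, q (Fin.castSucc i) ^ 2 = 1)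
    (hq5 : q 5 = 0) (hB : |z 5| ≤ B) (hτ : 1 ≤ τ) (ht : tail τ ≤ 1) :
    (1 - tail τ) * Real.exp (-(B ^ 2) / (4 * τ)) ≤ cylKernel q τ z := by
  rw [cylKernel_eq, hq5, sub_zero]
  have hzon := one_sub_tail_le_zonal hτ (abs_sum_mul_le_one hz hq)
  have hexp : Real.exp (-(B ^ 2) / (4 * τ)) ≤ Real.exp (-(z 5 ^ 2) / (4 * τ)) := by
    rw [Real.exp_le_exp]
    have hsq : z 5 ^ 2 ≤ B ^ 2 := by
      have hB0 : 0 ≤ B := (abs_nonneg _).trans hB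
      nlinarith [abs_le.1 hB, sq_abs (z 5)]
    have h4 : (0 : ℝ) < 4 * τ := by linarith
    rw [div_le_div_iff_of_pos_right h4]  -- placeholder name
    linarith
  calc (1 - tail τ) * Real.exp (-(B ^ 2) / (4 * τ))
      ≤ (1 - tail τ) * Real.exp (-(z 5 ^ 2) / (4 * τ)) :=
        mul_le_mul_of_nonneg_left hexp (by linarith)
    _ ≤ _ := mul_le_mul_of_nonneg_right hzon (Real.exp_pos _).le

/-- **Lower bound of the typed density**: `ofReal((1-t(τ)) e^{-B²/4τ}) · μH(A)/μH(S⁴) ≤ F̂_{q,τ}(A)`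
for measurable `A ⊆ N` with `|z₅| ≤ B` on `A`, `q ∈ N ∩ {z₅ = 0}`, `τ ≥ 1`. [folklore] -/
theorem lowerFactor_mul_le_cylDensity {A : Set (EuclideanSpace ℝ (Fin 6))} (hAm : MeasurableSet A)
    (hAN : ∀ z ∈ A, ∑ i : Fin 5, z (Fin.castSucc i) ^ 2 = 1) {B : ℝ} (hB : ∀ z ∈ A, |z 5| ≤ B)
    {q : EuclideanSpace ℝ (Fin 6)} (hq : ∑ i : Fin 5, q (Fin.castSucc i) ^ 2 = 1) (hq5 : q 5 = 0)
    {τ : ℝ} (hτ : 1 ≤ τ) :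
    ENNReal.ofReal ((1 - tail τ) * Real.exp (-(B ^ 2) / (4 * τ))) *
        ((μH[4] (Metric.sphere (0 : EuclideanSpace ℝ (Fin 5)) 1))⁻¹ * μH[4] A) ≤ cylDensity A q τ := by
  rw [cylDensity, mul_left_comm]
  gcongr
  rw [← setLIntegral_const]
  refine setLIntegral_mono' hAm fun z hz => ?_
  by_cases ht : tail τ ≤ 1
  · exact ENNReal.ofReal_le_ofReal (lowerFactor_le_cylKernel (hAN z hz) hq hq5 (hB z hz) hτ ht)
  · rw [ENNReal.ofReal_of_nonpos]
    · exact bot_le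
    · exact mul_nonpos_of_nonpos_of_nonneg (by linarith) (Real.exp_pos _).le

/-- The lower factor tends to `1` as `τ → ∞`. [folklore] -/
theorem tendsto_lowerFactor (B : ℝ) :
    Tendsto (fun τ : ℝ => (1 - tail τ) * Real.exp (-(B ^ 2) / (4 * τ))) atTop (𝓝 1) := by
  have h1 : Tendsto (fun τ : ℝ => Real.exp (-τ)) atTop (𝓝 0) := Real.tendsto_exp_neg_atTop_nhds_zero
  have htail : Tendsto tail atTop (𝓝 0) := by
    have h := h1.div (tendsto_const_nhds.sub h1) (by norm_num : (1 : ℝ) - 0 ≠ 0)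
    rw [zero_div] at h
    exact h
  have h2 : Tendsto (fun τ : ℝ => 1 - tail τ) atTop (𝓝 1) := by
    simpa using tendsto_const_nhds.sub htail
  have h3 : Tendsto (fun τ : ℝ => Real.exp (-(B ^ 2) / (4 * τ))) atTop (𝓝 1) := by
    have h4 : Tendsto (fun τ : ℝ => -(B ^ 2) / 4 * τ⁻¹) atTop (𝓝 (-(B ^ 2) / 4 * 0)) :=
      tendsto_inv_atTop_zero.const_mul _
    rw [mul_zero] at h4
    have h5 := (Real.continuous_exp.tendsto 0).comp h4
    rw [Real.exp_zero] at h5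
    refine h5.congr fun τ => ?_
    simp only [Function.comp_apply]
    congr 1
    ring
  simpa using h2.mul h3

/-- A centre on the slice `{z₅ = 0}` of `N`: `q = e₀`. [folklore] -/
theorem exists_center : ∃ q : EuclideanSpace ℝ (Fin 6),
    (∑ i : Fin 5, q (Fin.castSucc i) ^ 2 = 1) ∧ q 5 = 0 := by
  refine ⟨EuclideanSpace.single 0 1, ?_, by simp⟩
  rw [Finset.sum_eq_single (0 : Fin 5)]
  · simp
  · intro i _ hi
    have : (Fin.castSucc i : Fin 6) ≠ 0 := fun h => hi (Fin.castSucc_eq_zero_iff.1 h)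
    simp [this]
  · simp

/-- **`μH(A)/μH(S⁴) ≤ λ_cyl(A)`** for measurable `A ⊆ N` of bounded height (the `τ → ∞` end of the
supremum, centred on the slice `{z₅ = 0}`). [folklore] -/
theorem measure_ratio_le_cylEntropy {A : Set (EuclideanSpace ℝ (Fin 6))} (hAm : MeasurableSet A)
    (hAN : ∀ z ∈ A, ∑ i : Fin 5, z (Fin.castSucc i) ^ 2 = 1) {B : ℝ} (hB : ∀ z ∈ A, |z 5| ≤ B) :
    (μH[4] (Metric.sphere (0 : EuclideanSpace ℝ (Fin 5)) 1))⁻¹ * μH[4] A ≤ cylEntropy A := by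
  obtain ⟨q, hq, hq5⟩ := exists_center
  refine ENNReal.le_of_forall_lt_one_mul_le fun a ha => ?_
  have ha' : a.toReal < 1 := by
    have := (ENNReal.toReal_lt_toReal ha.ne_top ENNReal.one_ne_top).2 ha
    simpa using this
  obtain ⟨τ, hτ1, hτa⟩ : ∃ τ : ℝ, 1 ≤ τ ∧ a.toReal < (1 - tail τ) * Real.exp (-(B ^ 2) / (4 * τ)) :=
    ((eventually_ge_atTop 1).and ((tendsto_order.1 (tendsto_lowerFactor B)).1 _ ha')).exists
  have hle : a ≤ ENNReal.ofReal ((1 - tail τ) * Real.exp (-(B ^ 2) / (4 * τ))) := by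
    rw [← ENNReal.ofReal_toReal ha.ne_top]
    exact ENNReal.ofReal_le_ofReal hτa.le
  calc a * ((μH[4] (Metric.sphere (0 : EuclideanSpace ℝ (Fin 5)) 1))⁻¹ * μH[4] A)
      ≤ ENNReal.ofReal ((1 - tail τ) * Real.exp (-(B ^ 2) / (4 * τ))) *
          ((μH[4] (Metric.sphere (0 : EuclideanSpace ℝ (Fin 5)) 1))⁻¹ * μH[4] A) := by
        gcongr
    _ ≤ cylDensity A q τ := lowerFactor_mul_le_cylDensity hAm hAN hB hq hq5 hτ1
    _ ≤ cylEntropy A := by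
        refine le_iSup_of_le q (le_iSup_of_le hq (le_iSup_of_le τ (le_iSup_of_le (by linarith) le_rfl)))


/-- `padL` preserves the Euclidean norm. [folklore] -/
theorem norm_padL (y : EuclideanSpace ℝ (Fin 5)) : ‖padL y‖ = ‖y‖ := by
  rw [EuclideanSpace.norm_eq, EuclideanSpace.norm_eq, Fin.sum_univ_castSucc]
  simp

/-- The slice map `x ↦ (x, c)` is an isometry onto its image. [folklore] -/
theorem isometry_sliceMap (c : ℝ) : Isometry (sliceMap c) := by
  refine Isometry.of_dist_eq fun x y => ?_
  rw [sliceMap, sliceMap, dist_add_right, dist_eq_norm, ← map_sub, norm_padL, ← dist_eq_norm,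
    Subtype.dist_eq]

/-- **The slice has the Hausdorff measure of `S⁴`**: `μH[4](S⁴ × {c}) = μH[4](S⁴ ⊂ ℝ⁵)`
(isometry invariance). [folklore] -/
theorem hausdorffMeasure_range_sliceMap (c : ℝ) :
    μH[4] (Set.range (sliceMap c)) = μH[4] (Metric.sphere (0 : EuclideanSpace ℝ (Fin 5)) 1) := by
  rw [← Set.image_univ, (isometry_sliceMap c).hausdorffMeasure_image (Or.inl (by norm_num)) Set.univ,
    ← (isometry_subtype_coe (s := Metric.sphere (0 : EuclideanSpace ℝ (Fin 5)) 1)).hausdorffMeasure_image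
      (Or.inl (by norm_num)) Set.univ, Set.image_univ, Subtype.range_coe]

/-- The slice is a measurable (indeed compact) subset of `ℝ⁶`. [folklore] -/
theorem measurableSet_range_sliceMap (c : ℝ) : MeasurableSet (Set.range (sliceMap c)) :=
  (isCompact_range (isometry_sliceMap c).continuous).isClosed.measurableSet

/-- **Half of the calibration, proved: `1 ≤ λ_cyl(slice)`** for every slice `S⁴ × {c}` (the `τ → ∞`
limit of `F̂_{e₀,τ}`; the other half `≤ 1` is the Funk–Hecke computation of item `SliceCalibration`). [folklore] -/
theorem one_le_cylEntropy_slice (c : ℝ) : 1 ≤ cylEntropy (Set.range (sliceMap c)) := by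
  have h := measure_ratio_le_cylEntropy (measurableSet_range_sliceMap c)
    (fun z hz => by rw [range_sliceMap] at hz; exact hz.1) (B := |c|)
    (fun z hz => by rw [range_sliceMap] at hz; rw [hz.2])
  rwa [hausdorffMeasure_range_sliceMap, ENNReal.inv_mul_cancel hausdorffMeasure_sphere_four_pos.ne'
    hausdorffMeasure_sphere_four_lt_top.ne] at h

/-- **Entropy floor from an area floor**: a measurable `A ⊆ N` of bounded height with
`μH[4](S⁴) ≤ μH[4](A)` has `λ_cyl(A) ≥ 1`. [folklore] -/
theorem one_le_cylEntropy_of_measure_le {A : Set (EuclideanSpace ℝ (Fin 6))} (hAm : MeasurableSet A)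
    (hAN : ∀ z ∈ A, ∑ i : Fin 5, z (Fin.castSucc i) ^ 2 = 1) {B : ℝ} (hB : ∀ z ∈ A, |z 5| ≤ B)
    (hfloor : μH[4] (Metric.sphere (0 : EuclideanSpace ℝ (Fin 5)) 1) ≤ μH[4] A) : 1 ≤ cylEntropy A := by
  refine le_trans ?_ (measure_ratio_le_cylEntropy hAm hAN hB)
  calc (1 : ℝ≥0∞) = (μH[4] (Metric.sphere (0 : EuclideanSpace ℝ (Fin 5)) 1))⁻¹ *
        μH[4] (Metric.sphere (0 : EuclideanSpace ℝ (Fin 5)) 1) :=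
        (ENNReal.inv_mul_cancel hausdorffMeasure_sphere_four_pos.ne' hausdorffMeasure_sphere_four_lt_top.ne).symm
    _ ≤ _ := by gcongr


/-! ### The area floor: a set separating the ends of `N` has `μH[4] ≥ μH[4](S⁴)` -/

/-- Drop the last coordinate: `ℝ⁶ → ℝ⁵`, as a continuous linear map. [folklore] -/
def truncL : EuclideanSpace ℝ (Fin 6) →L[ℝ] EuclideanSpace ℝ (Fin 5) :=
  (EuclideanSpace.equiv (Fin 5) ℝ).symm.toContinuousLinearMap.comp
    (ContinuousLinearMap.pi fun i : Fin 5 => EuclideanSpace.proj (Fin.castSucc i))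

/-- Coordinates of the truncation. [folklore] -/
@[simp] theorem truncL_apply (z : EuclideanSpace ℝ (Fin 6)) (i : Fin 5) :
    truncL z i = z (Fin.castSucc i) := by
  simp [truncL]

/-- The truncation does not increase the norm. [folklore] -/
theorem norm_truncL_le (z : EuclideanSpace ℝ (Fin 6)) : ‖truncL z‖ ≤ ‖z‖ := by
  rw [EuclideanSpace.norm_eq, EuclideanSpace.norm_eq]
  refine Real.sqrt_le_sqrt ?_
  rw [Fin.sum_univ_castSucc (f := fun j : Fin 6 => ‖z j‖ ^ 2)]
  simp only [truncL_apply]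
  linarith [sq_nonneg ‖z (Fin.last 5)‖]

/-- The truncation is 1-Lipschitz. [folklore] -/
theorem lipschitz_truncL : LipschitzWith 1 truncL := by
  refine LipschitzWith.of_dist_le_mul fun x y => ?_
  rw [dist_eq_norm, dist_eq_norm, ← map_sub, NNReal.coe_one, one_mul]
  exact norm_truncL_le _

/-- **Area floor.** If a subset `A` of the cylinder `N = {∑_{i<5} zᵢ² = 1} ⊂ ℝ⁶` separates the two ends
of `N` in the typed sense of the route items of `SmoothPoincare4/CylinderEntropy` (no path in `N ∖ A` from
height `≤ -R` to height `≥ R`), then `μH[4](S⁴ ⊂ ℝ⁵) ≤ μH[4](A)`: the 1-Lipschitz truncation maps `A` onto a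
set containing the unit sphere (a missed point `q` gives the vertical segment `{q} × [-(|R|+1), |R|+1]` in
`N ∖ A` joining the ends), and Lipschitz maps do not increase `μH[4]` (Federer 2.10.11).  This is the
support item `AreaFloor` of that route for `A = range ι`, with no manifold structure needed. [folklore] -/
theorem hausdorffMeasure_sphere_le_of_separatesEnds {A : Set (EuclideanSpace ℝ (Fin 6))} {R : ℝ}
    (hR : ∀ a b : EuclideanSpace ℝ (Fin 6), ∑ i : Fin 5, a (Fin.castSucc i) ^ 2 = 1 →
      ∑ i : Fin 5, b (Fin.castSucc i) ^ 2 = 1 → a 5 ≤ -R → R ≤ b 5 →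
        ¬ JoinedIn ({z : EuclideanSpace ℝ (Fin 6) | ∑ i : Fin 5, z (Fin.castSucc i) ^ 2 = 1} \ A) a b) :
    μH[4] (Metric.sphere (0 : EuclideanSpace ℝ (Fin 5)) 1) ≤ μH[4] A := by
  have hcover : Metric.sphere (0 : EuclideanSpace ℝ (Fin 5)) 1 ⊆ truncL '' A := by
    intro q hq
    by_contra hmiss
    have hq1 : ∑ i : Fin 5, q i ^ 2 = 1 := by
      have h1 : ‖q‖ = 1 := mem_sphere_zero_iff_norm.mp hq
      have h2 := EuclideanSpace.norm_sq_eq q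
      rw [h1, one_pow] at h2
      simpa [Real.norm_eq_abs, sq_abs] using h2.symm
    let e : ℝ → EuclideanSpace ℝ (Fin 6) := fun h =>
      (EuclideanSpace.equiv (Fin 6) ℝ).symm (Fin.snoc (fun i : Fin 5 => q i) h)
    have he_cast : ∀ h (i : Fin 5), e h (Fin.castSucc i) = q i := by
      intro h i; simp [e]
    have he_last : ∀ h, e h 5 = h := by
      intro h
      have h1 : Fin.snoc (α := fun _ : Fin 6 => ℝ) (fun i : Fin 5 => q i) h (Fin.last 5) = h :=
        Fin.snoc_last _ _
      simpa [e] using h1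
    have hmemN : ∀ h, ∑ i : Fin 5, e h (Fin.castSucc i) ^ 2 = 1 := by
      intro h; simp only [he_cast]; exact hq1
    have hseg : segment ℝ (e (-(|R| + 1))) (e (|R| + 1)) ⊆
        {z : EuclideanSpace ℝ (Fin 6) | ∑ i : Fin 5, z (Fin.castSucc i) ^ 2 = 1} \ A := by
      rintro w ⟨a, b, ha, hb, hab, rfl⟩
      have hw : ∀ i : Fin 5, (a • e (-(|R| + 1)) + b • e (|R| + 1)) (Fin.castSucc i) = q i := by
        intro i
        simp only [PiLp.add_apply, PiLp.smul_apply, smul_eq_mul, he_cast]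
        rw [← add_mul, hab, one_mul]
      refine ⟨by simp only [Set.mem_setOf_eq, hw]; exact hq1, fun hwA => hmiss ⟨_, hwA, ?_⟩⟩
      ext i
      rw [truncL_apply, hw]
    exact hR _ _ (hmemN _) (hmemN _) (by rw [he_last]; linarith [le_abs_self R])
      (by rw [he_last]; linarith [le_abs_self R]) (JoinedIn.of_segment_subset hseg)
  calc μH[4] (Metric.sphere (0 : EuclideanSpace ℝ (Fin 5)) 1)
      ≤ μH[4] (truncL '' A) := measure_mono hcover
    _ ≤ (1 : ℝ≥0∞) ^ (4 : ℝ) * μH[4] A := lipschitz_truncL.hausdorffMeasure_image_le (by norm_num) _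
    _ = μH[4] A := by simp

/-- **Entropy floor for separating sets**: a measurable `A ⊆ N` of bounded height separating the ends of
`N` has typed cylinder entropy `≥ 1` (area floor + the `τ → ∞` end of the supremum).  In particular every
compact cross-section of the route items has `λ_cyl ≥ 1`, and the threshold family of the crux
`SliceIsolation` is vacuous below `1`. [folklore] -/
theorem one_le_cylEntropy_of_separatesEnds {A : Set (EuclideanSpace ℝ (Fin 6))} (hAm : MeasurableSet A)
    (hAN : ∀ z ∈ A, ∑ i : Fin 5, z (Fin.castSucc i) ^ 2 = 1) {B : ℝ} (hB : ∀ z ∈ A, |z 5| ≤ B) {R : ℝ}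
    (hR : ∀ a b : EuclideanSpace ℝ (Fin 6), ∑ i : Fin 5, a (Fin.castSucc i) ^ 2 = 1 →
      ∑ i : Fin 5, b (Fin.castSucc i) ^ 2 = 1 → a 5 ≤ -R → R ≤ b 5 →
        ¬ JoinedIn ({z : EuclideanSpace ℝ (Fin 6) | ∑ i : Fin 5, z (Fin.castSucc i) ^ 2 = 1} \ A) a b) :
    1 ≤ cylEntropy A :=
  one_le_cylEntropy_of_measure_le hAm hAN hB (hausdorffMeasure_sphere_le_of_separatesEnds hR)

end Literature.Geometry.Riemannian.SphericalCylinderEntropy
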